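import Mathlib
import Summits.PneNP.PneNP.Theorems.OverlapGapAlgebraSolvableImpliesStableSectionMonotoneRepairTreeFamily
import Summits.PneNP.PneNP.Theorems.OverlapGapAlgebraSolvableImpliesStableSectionTwoWayRepairDynamics

/-!
# PneNP / OverlapGapAlgebra — crux `SolvableImpliesStableSection` (stmt-PneNP-2463):
# the TWO-WAY REPAIR block (6/·) — the subtree hanging at a slot of a violated clause

Support for crux `stmt-PneNP-2463` (`Summit.PneNP.PneNP.Theses.OverlapGapAlgebra.SolvableImpliesStableSection`):
the f-free block "bounded-round two-way repair with one-round memory gives stable sections for every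
`ν > 0` up to `α ≤ 2^k/(4k)`".  The bridge from the dynamics (`…TwoWayRepairDynamics`) to the tree
codes, slot by slot.  Call a code GOOD for `(y, s)` (a clause violated at round `s`) if it lies in `TS s`,
is rooted at `(y, r)` with `r / 2 = s`, is syntactically valid in `Φ` (two-way sign rule), locally valid,
has a childless root slot — unique if `r` is odd — and its least childless root slot is the NOMINEE `jf`
of `y` at round `s`, with `r` odd iff `(y, jf)` is positive.  Given good codes for all clauses violated
before round `t` (induction hypothesis) and a clause `i` violated at round `t`:

* `sissW_key_ne_zero` — a slot of nonzero class flipped at the last round or is positive;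
* `sissW_child_recent` — a slot of `i` whose variable flipped at round `t - 1` bears the good code of
  the clause that nominated it at round `t - 1` (round `t - 1`, edge equation, and the parity relation
  "slot positive iff child code even");
* `sissW_child_positive` — a positive slot of `i` whose variable did not flip at the last round bears
  the good code of a clause that flipped its variable from `true` to `false` earlier (even code).
No definitions (all objects are hypotheses); axioms `propext`, `Classical.choice`, `Quot.sound`.
-/

set_option linter.dupNamespace false -- `Summit.PneNP.PneNP.…`: summit = sub-problem (D-0017)

namespace Summit.PneNP.PneNP.Theorems

open Finset
open scoped Classical

section BuildSlot

variable {m k n : ℕ}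

/-- A slot of nonzero class flipped at the last round or is positive. -/
theorem sissW_key_ne_zero (val : ℕ → (Fin m → Fin k → Fin n × Bool) → Fin n → Bool) (t : ℕ) (Φ : (Fin m → Fin k → Fin n × Bool)) (i : Fin m) (j : Fin k)
    (h : (if 1 ≤ t ∧ val t Φ (Φ i j).1 ≠ val (t - 1) Φ (Φ i j).1 then (2 : ℕ)
          else if (Φ i j).2 = true then 1 else 0) ≠ 0) : ((1 ≤ t ∧ val t Φ (Φ i j).1 ≠ val (t - 1) Φ (Φ i j).1)) ∨ (Φ i j).2 = true := by
  by_contra hcon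
  rw [not_or] at hcon
  refine h ((sissW_key_eq_zero val t Φ i j).2 ⟨hcon.1, ?_⟩)
  simpa using hcon.2

/-- **The subtree at a recent slot.** If the variable of slot `(i, j)` flipped at the last round
(`val t ≠ val (t-1)`, `t ≥ 1`) and clause `i` is violated at round `t`, then — given good codes for the
clauses violated before round `t` — the good code of the clause that nominated this variable at round
`t - 1` is a valid child for slot `j`: root round `t - 1`, edge equation, slot `(i, j)` positive iff the
child's root code is even. -/
theorem sissW_child_recent (TS : ℕ → Finset (Finset (List (Fin k) × (Fin m × ℕ))))
    (val : ℕ → (Fin m → Fin k → Fin n × Bool) → Fin n → Bool)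
    (hvalW : ∀ (t : ℕ) (Φ : (Fin m → Fin k → Fin n × Bool)) (v : Fin n), val (t + 1) Φ v = val t Φ v ↔
      ¬ (∃ ii : Fin m, (∀ jj : Fin k, val t Φ (Φ ii jj).1 ≠ (Φ ii jj).2) ∧
        ∃ jf : Fin k, (∀ j' : Fin k, (if 1 ≤ t ∧ val t Φ (Φ ii jf).1 ≠ val (t - 1) Φ (Φ ii jf).1 then (2 : ℕ)
          else if (Φ ii jf).2 = true then 1 else 0) < (if 1 ≤ t ∧ val t Φ (Φ ii j').1 ≠ val (t - 1) Φ (Φ ii j').1 then (2 : ℕ)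
          else if (Φ ii j').2 = true then 1 else 0) ∨
        ((if 1 ≤ t ∧ val t Φ (Φ ii jf).1 ≠ val (t - 1) Φ (Φ ii jf).1 then (2 : ℕ)
          else if (Φ ii jf).2 = true then 1 else 0) = (if 1 ≤ t ∧ val t Φ (Φ ii j').1 ≠ val (t - 1) Φ (Φ ii j').1 then (2 : ℕ)
          else if (Φ ii j').2 = true then 1 else 0) ∧ jf ≤ j')) ∧ (Φ ii jf).1 = v))
    (Φ : (Fin m → Fin k → Fin n × Bool)) (t : ℕ) (i : Fin m) (j : Fin k) (hviol : (∀ jj : Fin k, val t Φ (Φ i jj).1 ≠ (Φ i jj).2))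
    (hrec : (1 ≤ t ∧ val t Φ (Φ i j).1 ≠ val (t - 1) Φ (Φ i j).1))
    (hIH : (∀ s : ℕ, s < t → ∀ y : Fin m, (∀ jj : Fin k, val s Φ (Φ y jj).1 ≠ (Φ y jj).2) →
      ∃ (T : Finset (List (Fin k) × (Fin m × ℕ))) (r : ℕ) (jf : Fin k), (T ∈ TS s ∧ r / 2 = s ∧ (([] : List (Fin k)), (y, r)) ∈ T ∧
      (∀ e ∈ T, ∀ j : Fin k,
      (((Φ e.2.1 j).2 = true ↔ ((∃ (y : Fin m) (s : ℕ), (j :: e.1, (y, s)) ∈ T ∧ s % 2 = 0) ∨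
        ((∀ lab : Fin m × ℕ, (j :: e.1, lab) ∉ T) ∧ e.2.2 % 2 = 1))) ∧
      ∀ (y : Fin m) (s : ℕ), (j :: e.1, (y, s)) ∈ T → ∃ j' : Fin k,
        (∀ lab : Fin m × ℕ, (j' :: j :: e.1, lab) ∉ T) ∧
        (∀ j'' : Fin k, j'' < j' → ∃ lab : Fin m × ℕ, (j'' :: j :: e.1, lab) ∈ T) ∧
        (Φ e.2.1 j).1 = (Φ y j').1)) ∧
      ((∀ e ∈ T, ∀ (j : Fin k) (y : Fin m) (s : ℕ), (j :: e.1, (y, s)) ∈ T →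
        s / 2 < e.2.2 / 2 ∧ ∃ j' : Fin k, ∀ lab : Fin m × ℕ, (j' :: j :: e.1, lab) ∉ T) ∧
      (∀ e ∈ T, ∀ (j : Fin k) (y : Fin m) (s : ℕ), (j :: e.1, (y, s)) ∈ T → s % 2 = 1 →
        ∀ j₁ j₂ : Fin k, (∀ lab : Fin m × ℕ, (j₁ :: j :: e.1, lab) ∉ T) →
          (∀ lab : Fin m × ℕ, (j₂ :: j :: e.1, lab) ∉ T) → j₁ = j₂) ∧
      (∀ e ∈ T, 1 ≤ e.2.2 / 2 → ∃ (j : Fin k) (y : Fin m) (s : ℕ),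
        (j :: e.1, (y, s)) ∈ T ∧ s / 2 + 1 = e.2.2 / 2)) ∧
      (∃ j : Fin k, ∀ lab : Fin m × ℕ, ([j], lab) ∉ T) ∧
      (∀ (y : Fin m) (s : ℕ), (([] : List (Fin k)), (y, s)) ∈ T → s % 2 = 1 →
        ∀ j₁ j₂ : Fin k, (∀ lab : Fin m × ℕ, ([j₁], lab) ∉ T) →
          (∀ lab : Fin m × ℕ, ([j₂], lab) ∉ T) → j₁ = j₂) ∧
      (∀ j' : Fin k, (if 1 ≤ s ∧ val s Φ (Φ y jf).1 ≠ val (s - 1) Φ (Φ y jf).1 then (2 : ℕ)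
          else if (Φ y jf).2 = true then 1 else 0) < (if 1 ≤ s ∧ val s Φ (Φ y j').1 ≠ val (s - 1) Φ (Φ y j').1 then (2 : ℕ)
          else if (Φ y j').2 = true then 1 else 0) ∨
        ((if 1 ≤ s ∧ val s Φ (Φ y jf).1 ≠ val (s - 1) Φ (Φ y jf).1 then (2 : ℕ)
          else if (Φ y jf).2 = true then 1 else 0) = (if 1 ≤ s ∧ val s Φ (Φ y j').1 ≠ val (s - 1) Φ (Φ y j').1 then (2 : ℕ)
          else if (Φ y j').2 = true then 1 else 0) ∧ jf ≤ j')) ∧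
      (∀ lab : Fin m × ℕ, ([jf], lab) ∉ T) ∧ (∀ j'' : Fin k, j'' < jf → ∃ lab : Fin m × ℕ, ([j''], lab) ∈ T) ∧
      (r % 2 = 1 ↔ (Φ y jf).2 = true)))) :
    ∃ S : Finset (List (Fin k) × (Fin m × ℕ)), (∃ (y : Fin m) (s r' : ℕ) (jf' : Fin k), s < t ∧ S ∈ TS s ∧ (([] : List (Fin k)), (y, r')) ∈ S ∧ r' / 2 = s ∧
      (∀ e ∈ S, ∀ j : Fin k,
      (((Φ e.2.1 j).2 = true ↔ ((∃ (y : Fin m) (s : ℕ), (j :: e.1, (y, s)) ∈ S ∧ s % 2 = 0) ∨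
        ((∀ lab : Fin m × ℕ, (j :: e.1, lab) ∉ S) ∧ e.2.2 % 2 = 1))) ∧
      ∀ (y : Fin m) (s : ℕ), (j :: e.1, (y, s)) ∈ S → ∃ j' : Fin k,
        (∀ lab : Fin m × ℕ, (j' :: j :: e.1, lab) ∉ S) ∧
        (∀ j'' : Fin k, j'' < j' → ∃ lab : Fin m × ℕ, (j'' :: j :: e.1, lab) ∈ S) ∧
        (Φ e.2.1 j).1 = (Φ y j').1)) ∧
      ((∀ e ∈ S, ∀ (j : Fin k) (y : Fin m) (s : ℕ), (j :: e.1, (y, s)) ∈ S →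
        s / 2 < e.2.2 / 2 ∧ ∃ j' : Fin k, ∀ lab : Fin m × ℕ, (j' :: j :: e.1, lab) ∉ S) ∧
      (∀ e ∈ S, ∀ (j : Fin k) (y : Fin m) (s : ℕ), (j :: e.1, (y, s)) ∈ S → s % 2 = 1 →
        ∀ j₁ j₂ : Fin k, (∀ lab : Fin m × ℕ, (j₁ :: j :: e.1, lab) ∉ S) →
          (∀ lab : Fin m × ℕ, (j₂ :: j :: e.1, lab) ∉ S) → j₁ = j₂) ∧
      (∀ e ∈ S, 1 ≤ e.2.2 / 2 → ∃ (j : Fin k) (y : Fin m) (s : ℕ),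
        (j :: e.1, (y, s)) ∈ S ∧ s / 2 + 1 = e.2.2 / 2)) ∧
      (∃ j : Fin k, ∀ lab : Fin m × ℕ, ([j], lab) ∉ S) ∧
      (∀ (y : Fin m) (s : ℕ), (([] : List (Fin k)), (y, s)) ∈ S → s % 2 = 1 →
        ∀ j₁ j₂ : Fin k, (∀ lab : Fin m × ℕ, ([j₁], lab) ∉ S) →
          (∀ lab : Fin m × ℕ, ([j₂], lab) ∉ S) → j₁ = j₂) ∧
      (∀ lab : Fin m × ℕ, ([jf'], lab) ∉ S) ∧ (∀ j'' : Fin k, j'' < jf' → ∃ lab : Fin m × ℕ, ([j''], lab) ∈ S) ∧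
      (Φ i j).1 = (Φ y jf').1 ∧ (((Φ i j).2 = true) ↔ r' % 2 = 0) ∧
      ((1 ≤ t ∧ val t Φ (Φ i j).1 ≠ val (t - 1) Φ (Φ i j).1) → s + 1 = t)) := by
  obtain ⟨ht1, hne⟩ := hrec
  set u : Fin n := (Φ i j).1 with hu
  -- the flip event at round `t - 1`
  have htt : t - 1 + 1 = t := Nat.sub_add_cancel ht1
  have hne' : val (t - 1 + 1) Φ u ≠ val (t - 1) Φ u := by rw [htt]; exact hne
  obtain ⟨y, hyviol, jf', hnom, hvar⟩ := sissW_rec_flip val hvalW (t - 1) Φ u hne'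
  have hflip := sissW_flip_ne val hvalW (t - 1) Φ u ⟨y, hyviol, jf', hnom, hvar⟩
  rw [htt] at hflip
  -- the good code of the nominator
  obtain ⟨S, r', jf'', hTS, hr', hroot, hsyn, hloc, hnoneS, huniq, hnom'', hjfno, hjflt, hpar⟩ :=
    hIH (t - 1) (by omega) y hyviol
  have hjj : jf'' = jf' := sissW_nom_unique val (t - 1) Φ y jf'' jf' hnom'' hnom
  subst hjj
  refine ⟨S, y, t - 1, r', jf'', by omega, hTS, hroot, hr', hsyn, hloc, hnoneS, huniq, hjfno, hjflt,
    hvar.symm, ?_, fun _ => htt⟩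
  -- parity: `(i, j)` positive iff `(y, jf'')` negative iff `r'` even
  have h1 := hyviol jf''
  have h2 := hviol j
  rw [hvar] at h1
  rw [← hu, hflip] at h2
  have key : (Φ i j).2 = true ↔ (Φ y jf'').2 = false := by
    revert h1 h2
    generalize val (t - 1) Φ u = a
    cases a <;> cases (Φ i j).2 <;> cases (Φ y jf'').2 <;> simp
  rw [key]
  constructor
  · intro hf
    rcases Nat.mod_two_eq_zero_or_one r' with h0 | h1'
    · exact h0
    · have := hpar.1 h1'
      rw [hf] at this
      exact absurd this (by simp)
  · intro h0 
    by_contra hcon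
    have htrue : (Φ y jf'').2 = true := by simpa using hcon
    have := hpar.2 htrue
    omega

/-- **The subtree at a positive, non-recent slot.** If slot `(i, j)` is positive, its variable did
not flip at the last round, and clause `i` is violated at round `t` (so the variable is `false`), then
the good code of a clause that flipped this variable from `true` to `false` at some round `s < t` is a
valid child for slot `j`, of even root code. -/
theorem sissW_child_positive (TS : ℕ → Finset (Finset (List (Fin k) × (Fin m × ℕ))))
    (val : ℕ → (Fin m → Fin k → Fin n × Bool) → Fin n → Bool)
    (hval0 : ∀ (Φ : (Fin m → Fin k → Fin n × Bool)) (v : Fin n), val 0 Φ v = true)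
    (hvalW : ∀ (t : ℕ) (Φ : (Fin m → Fin k → Fin n × Bool)) (v : Fin n), val (t + 1) Φ v = val t Φ v ↔
      ¬ (∃ ii : Fin m, (∀ jj : Fin k, val t Φ (Φ ii jj).1 ≠ (Φ ii jj).2) ∧
        ∃ jf : Fin k, (∀ j' : Fin k, (if 1 ≤ t ∧ val t Φ (Φ ii jf).1 ≠ val (t - 1) Φ (Φ ii jf).1 then (2 : ℕ)
          else if (Φ ii jf).2 = true then 1 else 0) < (if 1 ≤ t ∧ val t Φ (Φ ii j').1 ≠ val (t - 1) Φ (Φ ii j').1 then (2 : ℕ)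
          else if (Φ ii j').2 = true then 1 else 0) ∨
        ((if 1 ≤ t ∧ val t Φ (Φ ii jf).1 ≠ val (t - 1) Φ (Φ ii jf).1 then (2 : ℕ)
          else if (Φ ii jf).2 = true then 1 else 0) = (if 1 ≤ t ∧ val t Φ (Φ ii j').1 ≠ val (t - 1) Φ (Φ ii j').1 then (2 : ℕ)
          else if (Φ ii j').2 = true then 1 else 0) ∧ jf ≤ j')) ∧ (Φ ii jf).1 = v))
    (Φ : (Fin m → Fin k → Fin n × Bool)) (t : ℕ) (i : Fin m) (j : Fin k) (hviol : (∀ jj : Fin k, val t Φ (Φ i jj).1 ≠ (Φ i jj).2))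
    (hnrec : ¬ (1 ≤ t ∧ val t Φ (Φ i j).1 ≠ val (t - 1) Φ (Φ i j).1)) (hpos : (Φ i j).2 = true)
    (hIH : (∀ s : ℕ, s < t → ∀ y : Fin m, (∀ jj : Fin k, val s Φ (Φ y jj).1 ≠ (Φ y jj).2) →
      ∃ (T : Finset (List (Fin k) × (Fin m × ℕ))) (r : ℕ) (jf : Fin k), (T ∈ TS s ∧ r / 2 = s ∧ (([] : List (Fin k)), (y, r)) ∈ T ∧
      (∀ e ∈ T, ∀ j : Fin k,
      (((Φ e.2.1 j).2 = true ↔ ((∃ (y : Fin m) (s : ℕ), (j :: e.1, (y, s)) ∈ T ∧ s % 2 = 0) ∨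
        ((∀ lab : Fin m × ℕ, (j :: e.1, lab) ∉ T) ∧ e.2.2 % 2 = 1))) ∧
      ∀ (y : Fin m) (s : ℕ), (j :: e.1, (y, s)) ∈ T → ∃ j' : Fin k,
        (∀ lab : Fin m × ℕ, (j' :: j :: e.1, lab) ∉ T) ∧
        (∀ j'' : Fin k, j'' < j' → ∃ lab : Fin m × ℕ, (j'' :: j :: e.1, lab) ∈ T) ∧
        (Φ e.2.1 j).1 = (Φ y j').1)) ∧
      ((∀ e ∈ T, ∀ (j : Fin k) (y : Fin m) (s : ℕ), (j :: e.1, (y, s)) ∈ T →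
        s / 2 < e.2.2 / 2 ∧ ∃ j' : Fin k, ∀ lab : Fin m × ℕ, (j' :: j :: e.1, lab) ∉ T) ∧
      (∀ e ∈ T, ∀ (j : Fin k) (y : Fin m) (s : ℕ), (j :: e.1, (y, s)) ∈ T → s % 2 = 1 →
        ∀ j₁ j₂ : Fin k, (∀ lab : Fin m × ℕ, (j₁ :: j :: e.1, lab) ∉ T) →
          (∀ lab : Fin m × ℕ, (j₂ :: j :: e.1, lab) ∉ T) → j₁ = j₂) ∧
      (∀ e ∈ T, 1 ≤ e.2.2 / 2 → ∃ (j : Fin k) (y : Fin m) (s : ℕ),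
        (j :: e.1, (y, s)) ∈ T ∧ s / 2 + 1 = e.2.2 / 2)) ∧
      (∃ j : Fin k, ∀ lab : Fin m × ℕ, ([j], lab) ∉ T) ∧
      (∀ (y : Fin m) (s : ℕ), (([] : List (Fin k)), (y, s)) ∈ T → s % 2 = 1 →
        ∀ j₁ j₂ : Fin k, (∀ lab : Fin m × ℕ, ([j₁], lab) ∉ T) →
          (∀ lab : Fin m × ℕ, ([j₂], lab) ∉ T) → j₁ = j₂) ∧
      (∀ j' : Fin k, (if 1 ≤ s ∧ val s Φ (Φ y jf).1 ≠ val (s - 1) Φ (Φ y jf).1 then (2 : ℕ)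
          else if (Φ y jf).2 = true then 1 else 0) < (if 1 ≤ s ∧ val s Φ (Φ y j').1 ≠ val (s - 1) Φ (Φ y j').1 then (2 : ℕ)
          else if (Φ y j').2 = true then 1 else 0) ∨
        ((if 1 ≤ s ∧ val s Φ (Φ y jf).1 ≠ val (s - 1) Φ (Φ y jf).1 then (2 : ℕ)
          else if (Φ y jf).2 = true then 1 else 0) = (if 1 ≤ s ∧ val s Φ (Φ y j').1 ≠ val (s - 1) Φ (Φ y j').1 then (2 : ℕ)
          else if (Φ y j').2 = true then 1 else 0) ∧ jf ≤ j')) ∧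
      (∀ lab : Fin m × ℕ, ([jf], lab) ∉ T) ∧ (∀ j'' : Fin k, j'' < jf → ∃ lab : Fin m × ℕ, ([j''], lab) ∈ T) ∧
      (r % 2 = 1 ↔ (Φ y jf).2 = true)))) :
    ∃ S : Finset (List (Fin k) × (Fin m × ℕ)), (∃ (y : Fin m) (s r' : ℕ) (jf' : Fin k), s < t ∧ S ∈ TS s ∧ (([] : List (Fin k)), (y, r')) ∈ S ∧ r' / 2 = s ∧
      (∀ e ∈ S, ∀ j : Fin k,
      (((Φ e.2.1 j).2 = true ↔ ((∃ (y : Fin m) (s : ℕ), (j :: e.1, (y, s)) ∈ S ∧ s % 2 = 0) ∨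
        ((∀ lab : Fin m × ℕ, (j :: e.1, lab) ∉ S) ∧ e.2.2 % 2 = 1))) ∧
      ∀ (y : Fin m) (s : ℕ), (j :: e.1, (y, s)) ∈ S → ∃ j' : Fin k,
        (∀ lab : Fin m × ℕ, (j' :: j :: e.1, lab) ∉ S) ∧
        (∀ j'' : Fin k, j'' < j' → ∃ lab : Fin m × ℕ, (j'' :: j :: e.1, lab) ∈ S) ∧
        (Φ e.2.1 j).1 = (Φ y j').1)) ∧
      ((∀ e ∈ S, ∀ (j : Fin k) (y : Fin m) (s : ℕ), (j :: e.1, (y, s)) ∈ S →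
        s / 2 < e.2.2 / 2 ∧ ∃ j' : Fin k, ∀ lab : Fin m × ℕ, (j' :: j :: e.1, lab) ∉ S) ∧
      (∀ e ∈ S, ∀ (j : Fin k) (y : Fin m) (s : ℕ), (j :: e.1, (y, s)) ∈ S → s % 2 = 1 →
        ∀ j₁ j₂ : Fin k, (∀ lab : Fin m × ℕ, (j₁ :: j :: e.1, lab) ∉ S) →
          (∀ lab : Fin m × ℕ, (j₂ :: j :: e.1, lab) ∉ S) → j₁ = j₂) ∧
      (∀ e ∈ S, 1 ≤ e.2.2 / 2 → ∃ (j : Fin k) (y : Fin m) (s : ℕ),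
        (j :: e.1, (y, s)) ∈ S ∧ s / 2 + 1 = e.2.2 / 2)) ∧
      (∃ j : Fin k, ∀ lab : Fin m × ℕ, ([j], lab) ∉ S) ∧
      (∀ (y : Fin m) (s : ℕ), (([] : List (Fin k)), (y, s)) ∈ S → s % 2 = 1 →
        ∀ j₁ j₂ : Fin k, (∀ lab : Fin m × ℕ, ([j₁], lab) ∉ S) →
          (∀ lab : Fin m × ℕ, ([j₂], lab) ∉ S) → j₁ = j₂) ∧
      (∀ lab : Fin m × ℕ, ([jf'], lab) ∉ S) ∧ (∀ j'' : Fin k, j'' < jf' → ∃ lab : Fin m × ℕ, ([j''], lab) ∈ S) ∧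
      (Φ i j).1 = (Φ y jf').1 ∧ (((Φ i j).2 = true) ↔ r' % 2 = 0) ∧
      ((1 ≤ t ∧ val t Φ (Φ i j).1 ≠ val (t - 1) Φ (Φ i j).1) → s + 1 = t)) := by
  set u : Fin n := (Φ i j).1 with hu
  -- the variable is `false` at round `t`
  have hfalse : val t Φ u = false := by
    have := hviol j
    rw [hpos] at this
    simpa using this
  obtain ⟨s, hs, ⟨y, hyviol, jf', hnom, hvar⟩, hstrue, _⟩ :=
    sissW_exists_flip_false val hval0 hvalW Φ u t hfalse
  obtain ⟨S, r', jf'', hTS, hr', hroot, hsyn, hloc, hnoneS, huniq, hnom'', hjfno, hjflt, hpar⟩ :=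
    hIH s hs y hyviol
  have hjj : jf'' = jf' := sissW_nom_unique val s Φ y jf'' jf' hnom'' hnom
  subst hjj
  refine ⟨S, y, s, r', jf'', hs, hTS, hroot, hr', hsyn, hloc, hnoneS, huniq, hjfno, hjflt, hvar.symm, ?_,
    fun h => absurd h hnrec⟩
  -- the child's nominee slot is negative (its variable was `true`), so `r'` is even
  have hneg : (Φ y jf'').2 = false := by
    have := hyviol jf''
    rw [hvar, hstrue] at this
    cases hb : (Φ y jf'').2
    · rfl
    · rw [hb] at this; exact absurd rfl this
  rw [hpos]
  simp only [true_iff]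
  rcases Nat.mod_two_eq_zero_or_one r' with h0 | h1
  · exact h0
  · have := hpar.1 h1
    rw [hneg] at this
    exact absurd this (by simp)

end BuildSlot

end Summit.PneNP.PneNP.Theorems
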